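import Literature.NumberTheory.Rogawski1990.ArchEllipticOrbitHSBallThree                 -- ★ p849073 (B′): `hs_le_of_hs_conj_compactTorusRep₃_le` (orbit HS-ball ⊆ group HS-ball, radius `3√(1+4R∕m²)`)
import Literature.NumberTheory.Rogawski1990.ArchSchwartzOrbitalIntegralConvergenceElliptic  -- ★ p848739 LH3-p04 (g0) §1: `quotientMeasure_setOf_le_of_compact_of_group_bound` (compact centraliser: group bound ⇒ quotient bound)
import Literature.NumberTheory.Automorphic.UnitaryGroupArchimedeanPlaces                    -- ★ `UnitaryGroup.archLocal`, `mem_archLocal_iff`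
import HarnessLib

/-!
# (E′) Regular elliptic orbits of `U(2,1)`: a quadratic Haar growth of Hilbert–Schmidt balls gives LINEAR growth of the orbit sets `{g ∣ ‖gγg⁻¹‖²_HS ≤ R}`
# (the per-place `hgrp`∕`hplace` token at Ξ-exponent `e = 1`, modulo the group-side growth (T3-out-G))

Topic `NumberTheory/Rogawski1990`; namespace `Literature.NumberTheory.Rogawski1990`.  THEOREMS ONLY (no `def`, no instance, no notation, no axiom, no named fact,
no `sorry`).  Cell `pub/hodgecm-mathlib`, crux H413 (`stmt-HodgeConjecture-24833`), programme F0∕P3c «GO 500» half A, line LH2 (`stub_N8`); seat LH2-p02 (g2), word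
«(E′)» of LH2-plan (g0) 2026-09-02T04:10:08Z (2).  Label: **(VOL) kit, count-neutral; A3-hardening input for the letters O1″∕O3″ (and LH3's O1); not an organ.**

THE MATHEMATICS.  Let `Γ ≤ GL₃(ℂ)` be contained in `U(Φ₃)(ℂ)` (`Φ₃ = antidiag(1,1,1)`; e.g. `Γ = ` ★ `unitaryGroupOfForm (starRingEnd ℂ) Φ₃` or a place factor
★ `archLocal L 3 Φ₃ w` of `G_∞`), `γ ∈ Γ` with matrix the compact-Cartan representative `M(u₀,u₁,u₂)` (★ p848127), `|uᵢ| = 1`, `u₂ ∉ {u₀, u₁}`,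
`m = min(|u₀−u₂|², |u₁−u₂|²) > 0`.  By ★ `hs_le_of_hs_conj_compactTorusRep₃_le` (p849073),
`{g ∈ Γ ∣ Σ|(gγg⁻¹)_{ij}|² ≤ R} ⊆ {g ∈ Γ ∣ Σ|g_{ij}|² ≤ 3√(1 + 4R∕m²)}` — an orbit HS²-ball of radius `R` sits in a group HS²-ball of radius `≍ √R`.
Hence for ANY measure `ν` on `Γ` with QUADRATIC growth of HS²-balls, `ν{Σ|g_{ij}|² ≤ ρ} ≤ C ρ²` for `ρ ≥ 1` (for Haar measure on `U(2,1) = K A⁺ K` this is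
Harish-Chandra's count: `‖k a_t k′‖²_HS = 1 + 2cosh 2t ≍ e^{2t}`, Jacobian `sinh²t · sinh 2t ≍ e^{4t}` — the brick (T3-out-G), LH2-p01 (g3), NOT proved here and taken
as the hypothesis `hgrowth` in its posted shape), one gets the LINEAR orbit growth `ν{Σ|(gγg⁻¹)_{ij}|² ≤ R} ≤ 9C(1 + 4∕m²) · R` for `R ≥ 1`
(`measure_setOf_hs_conj_le_linear_of_quadratic_growth`) — the exponent `e = 1` of the Schwartz class ★ `ArchSchwartzOn L 3 Φ₃ 1` of the LH2 letters.  With a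
compact centraliser `Z(γ)` (the compact torus `U(1)³`) the bound descends to the Weil quotient measure `dν∕dt` on `Γ ⧸ Z(γ)` (★ p848739 §1), which is the per-place
token `hplace` (exponent `a = 1`) of the product assembly (Π′-G) (LH2-p03 (g3)) feeding ★ p848851 ∕ ★ p848739-type junctions
(`quotientMeasure_setOf_hs_conj_le_of_quadratic_growth`).
HONEST LABEL: HC_CM is proved only modulo the 7 printed citations (2 remaining: hLiu418 = stmt-HodgeConjecture-24832, h413 = stmt-HodgeConjecture-24833) until
rung 0 closes; this file closes no organ and is conditional on the named geometric input `hgrowth`.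

## References
* [BeuzartPlessis2020Asterisque] R. Beuzart-Plessis, *A local trace formula for the Gan–Gross–Prasad conjecture for unitary groups: the archimedean case*,
  Astérisque 418 (2020), author version: §1.2 (1.2.2), (1.2.4) p. 21 (orbit log-norm vs. `σ_{T∖G}`; Harish-Chandra's estimate), §1.8 p. 39 (absolute convergence of
  `J_G(x, f)`, `f ∈ 𝒞(G(F))`) (held scan `paper:doi-10-24033-ast-1120`).
* [Rogawski1990] J. D. Rogawski, *Automorphic Representations of Unitary Groups in Three Variables* (1990), §3.6 p. 28 (type (1) compact Cartan `U(1)³`), §1.9 p. 8.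
* [Folland1995] G. B. Folland, *A Course in Abstract Harmonic Analysis* (1995), §2.6 (2.52) (quotient measures), as used by ★ p848739 §1.
-/

set_option autoImplicit false

noncomputable section

open MeasureTheory NumberField
open Literature.NumberTheory.Automorphic Literature.MeasureTheory.Group
open scoped Matrix ComplexConjugate MatrixGroups ENNReal

namespace Literature.NumberTheory.Rogawski1990

/-! ## §1 Any subgroup of `U(Φ₃)(ℂ)`, any measure: quadratic HS-ball growth ⇒ linear orbit growth at a regular elliptic class -/

section GroupLevel

variable {Γ : Subgroup (GL (Fin 3) ℂ)}
  (hΓ : ∀ g : GL (Fin 3) ℂ, g ∈ Γ →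
    ((g : Matrix (Fin 3) (Fin 3) ℂ).map (starRingEnd ℂ))ᵀ * (Matrix.of fun i j : Fin 3 => if i.val + j.val + 1 = 3 then (1 : ℂ) else 0) *
        (g : Matrix (Fin 3) (Fin 3) ℂ) =
      (Matrix.of fun i j : Fin 3 => if i.val + j.val + 1 = 3 then (1 : ℂ) else 0))

include hΓ

/-- **Orbit HS²-ball ⊆ group HS²-ball, at the level of the subgroup `Γ ≤ U(Φ₃)(ℂ)`**: for `γ ∈ Γ` with matrix `M(u₀,u₁,u₂)`, `|uᵢ| = 1`, `u₂ ∉ {u₀,u₁}`,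
`{g ∣ Σ|(gγg⁻¹)_{ij}|² ≤ R} ⊆ {g ∣ Σ|g_{ij}|² ≤ 3√(1 + 4R∕m²)}` (★ `hs_le_of_hs_conj_compactTorusRep₃_le`). [cite: BeuzartPlessis2020Asterisque, §1.2 (1.2.2) p. 21] -/
theorem setOf_hs_conj_le_subset_setOf_hs_le {u₀ u₁ u₂ : ℂ} (h₀ : ‖u₀‖ = 1) (h₁ : ‖u₁‖ = 1) (h₂ : ‖u₂‖ = 1) (h₀₂ : u₀ ≠ u₂) (h₁₂ : u₁ ≠ u₂)
    {γ : Γ} (hγ : ((γ : GL (Fin 3) ℂ) : Matrix (Fin 3) (Fin 3) ℂ) =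
      !![(u₀ + u₂) / 2, 0, (u₀ - u₂) / 2; 0, u₁, 0; (u₀ - u₂) / 2, 0, (u₀ + u₂) / 2]) (R : ℝ) :
    {g : Γ | ∑ i : Fin 3, ∑ j : Fin 3, ‖(((g * γ * g⁻¹ : Γ) : GL (Fin 3) ℂ) : Matrix (Fin 3) (Fin 3) ℂ) i j‖ ^ 2 ≤ R} ⊆
      {g : Γ | ∑ i : Fin 3, ∑ j : Fin 3, ‖((g : GL (Fin 3) ℂ) : Matrix (Fin 3) (Fin 3) ℂ) i j‖ ^ 2 ≤
        3 * Real.sqrt (1 + 4 * R / (min (‖u₀ - u₂‖ ^ 2) (‖u₁ - u₂‖ ^ 2)) ^ 2)} := by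
  intro g hg
  simp only [Set.mem_setOf_eq] at hg ⊢
  have hy := hΓ (g : GL (Fin 3) ℂ) g.2
  have hmat : (((g * γ * g⁻¹ : Γ) : GL (Fin 3) ℂ) : Matrix (Fin 3) (Fin 3) ℂ) =
      ((g : GL (Fin 3) ℂ) : Matrix (Fin 3) (Fin 3) ℂ) * !![(u₀ + u₂) / 2, 0, (u₀ - u₂) / 2; 0, u₁, 0; (u₀ - u₂) / 2, 0, (u₀ + u₂) / 2] *
        ((g : GL (Fin 3) ℂ) : Matrix (Fin 3) (Fin 3) ℂ)⁻¹ := by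
    rw [← hγ, Subgroup.coe_mul, Subgroup.coe_mul, Subgroup.coe_inv, Units.val_mul, Units.val_mul, Matrix.coe_units_inv]
  rw [hmat] at hg
  exact hs_le_of_hs_conj_compactTorusRep₃_le hy h₀ h₁ h₂ h₀₂ h₁₂ hg

omit hΓ in
/-- The group radius `3√(1 + 4R∕m²)` is at least `1` (indeed `≥ 3`). [folklore] -/
private theorem one_le_radius (m R : ℝ) (hR : 0 ≤ R) : 1 ≤ 3 * Real.sqrt (1 + 4 * R / m ^ 2) := by
  have h1 : 1 ≤ 1 + 4 * R / m ^ 2 := by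
    have : 0 ≤ 4 * R / m ^ 2 := by positivity
    linarith
  have h2 : 1 ≤ Real.sqrt (1 + 4 * R / m ^ 2) := Real.one_le_sqrt.mpr h1
  linarith

/-- **(E′) LINEAR ORBIT GROWTH FROM QUADRATIC GROUP GROWTH** (any subgroup `Γ ≤ U(Φ₃)(ℂ)`, any measure `ν` on it): if `ν{g ∣ Σ|g_{ij}|² ≤ ρ} ≤ C ρ²` for `ρ ≥ 1`
(Harish-Chandra's `K A⁺ K` count on `U(2,1)`, hypothesis `hgrowth` = (T3-out-G)), then at a regular elliptic `γ` (matrix `M(u₀,u₁,u₂)`, `|uᵢ| = 1`, `u₂ ∉ {u₀,u₁}`)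
`ν{g ∣ Σ|(gγg⁻¹)_{ij}|² ≤ R} ≤ 9 max(C,0) (1 + 4∕m²) · R` for `R ≥ 1` — growth exponent `e = 1` in the HS² radius, the Ξ-exponent of ★ `ArchSchwartzOn L 3 Φ₃ 1`.
[cite: BeuzartPlessis2020Asterisque, §1.2 (1.2.2), (1.2.4) p. 21; §1.8 p. 39] -/
theorem measure_setOf_hs_conj_le_linear_of_quadratic_growth [MeasurableSpace Γ] (ν : Measure Γ)
    {u₀ u₁ u₂ : ℂ} (h₀ : ‖u₀‖ = 1) (h₁ : ‖u₁‖ = 1) (h₂ : ‖u₂‖ = 1) (h₀₂ : u₀ ≠ u₂) (h₁₂ : u₁ ≠ u₂)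
    {γ : Γ} (hγ : ((γ : GL (Fin 3) ℂ) : Matrix (Fin 3) (Fin 3) ℂ) =
      !![(u₀ + u₂) / 2, 0, (u₀ - u₂) / 2; 0, u₁, 0; (u₀ - u₂) / 2, 0, (u₀ + u₂) / 2])
    (hgrowth : ∃ C : ℝ, ∀ ρ : ℝ, 1 ≤ ρ →
      ν {g : Γ | ∑ i : Fin 3, ∑ j : Fin 3, ‖((g : GL (Fin 3) ℂ) : Matrix (Fin 3) (Fin 3) ℂ) i j‖ ^ 2 ≤ ρ} ≤ ENNReal.ofReal (C * ρ ^ 2)) :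
    ∃ A : ℝ, 0 ≤ A ∧ ∀ R : ℝ, 1 ≤ R →
      ν {g : Γ | ∑ i : Fin 3, ∑ j : Fin 3, ‖(((g * γ * g⁻¹ : Γ) : GL (Fin 3) ℂ) : Matrix (Fin 3) (Fin 3) ℂ) i j‖ ^ 2 ≤ R} ≤ ENNReal.ofReal (A * R) := by
  obtain ⟨C, hC⟩ := hgrowth
  set m : ℝ := min (‖u₀ - u₂‖ ^ 2) (‖u₁ - u₂‖ ^ 2) with hm
  have hm0 : 0 < m := by
    have ha : 0 < ‖u₀ - u₂‖ := norm_pos_iff.mpr (sub_ne_zero.mpr h₀₂)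
    have hb : 0 < ‖u₁ - u₂‖ := norm_pos_iff.mpr (sub_ne_zero.mpr h₁₂)
    exact lt_min (by positivity) (by positivity)
  refine ⟨9 * max C 0 * (1 + 4 / m ^ 2), by positivity, fun R hR => ?_⟩
  have hR0 : 0 ≤ R := by linarith
  -- inclusion, then the quadratic growth at radius `ρ = 3√(1 + 4R/m²) ≥ 3`
  have hsub := setOf_hs_conj_le_subset_setOf_hs_le hΓ h₀ h₁ h₂ h₀₂ h₁₂ hγ R
  have hρ := one_le_radius m R hR0
  calc ν {g : Γ | ∑ i : Fin 3, ∑ j : Fin 3, ‖(((g * γ * g⁻¹ : Γ) : GL (Fin 3) ℂ) : Matrix (Fin 3) (Fin 3) ℂ) i j‖ ^ 2 ≤ R}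
      ≤ ν {g : Γ | ∑ i : Fin 3, ∑ j : Fin 3, ‖((g : GL (Fin 3) ℂ) : Matrix (Fin 3) (Fin 3) ℂ) i j‖ ^ 2 ≤ 3 * Real.sqrt (1 + 4 * R / m ^ 2)} :=
        measure_mono hsub
    _ ≤ ENNReal.ofReal (C * (3 * Real.sqrt (1 + 4 * R / m ^ 2)) ^ 2) := hC _ hρ
    _ ≤ ENNReal.ofReal (9 * max C 0 * (1 + 4 / m ^ 2) * R) := by
        apply ENNReal.ofReal_le_ofReal
        have hsq : (3 * Real.sqrt (1 + 4 * R / m ^ 2)) ^ 2 = 9 * (1 + 4 * R / m ^ 2) := by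
          rw [mul_pow, Real.sq_sqrt (by positivity)]
          norm_num
        rw [hsq]
        have hCle : C ≤ max C 0 := le_max_left _ _
        have h1 : 1 + 4 * R / m ^ 2 ≤ (1 + 4 / m ^ 2) * R := by
          rw [add_mul, one_mul, div_mul_eq_mul_div]
          have : 0 ≤ 4 * R / m ^ 2 := by positivity
          nlinarith
        have h9 : 0 ≤ 9 * (1 + 4 * R / m ^ 2) := by positivity
        calc C * (9 * (1 + 4 * R / m ^ 2)) ≤ max C 0 * (9 * (1 + 4 * R / m ^ 2)) := mul_le_mul_of_nonneg_right hCle h9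
          _ ≤ max C 0 * (9 * ((1 + 4 / m ^ 2) * R)) := by gcongr
          _ = 9 * max C 0 * (1 + 4 / m ^ 2) * R := by ring

/-- The same in the `hgrp` shape of ★ p848739 ∕ ★ p848851 (`A R^e (1 + log R)^m` with `e = 1`, `m = 0`). [cite: BeuzartPlessis2020Asterisque, §1.8 p. 39] -/
theorem measure_setOf_hs_conj_le_rpow_one_of_quadratic_growth [MeasurableSpace Γ] (ν : Measure Γ)
    {u₀ u₁ u₂ : ℂ} (h₀ : ‖u₀‖ = 1) (h₁ : ‖u₁‖ = 1) (h₂ : ‖u₂‖ = 1) (h₀₂ : u₀ ≠ u₂) (h₁₂ : u₁ ≠ u₂)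
    {γ : Γ} (hγ : ((γ : GL (Fin 3) ℂ) : Matrix (Fin 3) (Fin 3) ℂ) =
      !![(u₀ + u₂) / 2, 0, (u₀ - u₂) / 2; 0, u₁, 0; (u₀ - u₂) / 2, 0, (u₀ + u₂) / 2])
    (hgrowth : ∃ C : ℝ, ∀ ρ : ℝ, 1 ≤ ρ →
      ν {g : Γ | ∑ i : Fin 3, ∑ j : Fin 3, ‖((g : GL (Fin 3) ℂ) : Matrix (Fin 3) (Fin 3) ℂ) i j‖ ^ 2 ≤ ρ} ≤ ENNReal.ofReal (C * ρ ^ 2)) :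
    ∃ (A : ℝ) (m : ℕ), ∀ R : ℝ, 1 ≤ R →
      ν {g : Γ | ∑ i : Fin 3, ∑ j : Fin 3, ‖(((g * γ * g⁻¹ : Γ) : GL (Fin 3) ℂ) : Matrix (Fin 3) (Fin 3) ℂ) i j‖ ^ 2 ≤ R} ≤
        ENNReal.ofReal (A * R ^ (1 : ℝ) * (1 + Real.log R) ^ m) := by
  obtain ⟨A, -, hA⟩ := measure_setOf_hs_conj_le_linear_of_quadratic_growth hΓ ν h₀ h₁ h₂ h₀₂ h₁₂ hγ hgrowth
  refine ⟨A, 0, fun R hR => ?_⟩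
  rw [Real.rpow_one, pow_zero, mul_one]
  exact hA R hR

end GroupLevel

/-! ## §2 Instances: the full unitary group `U(Φ₃)(ℂ)` and the place factors `U(Φ₃)_w` of `G_∞ = U(Φ₃)(L⁺ ⊗ ℝ)` -/

section Instances

/-- **(E′) on `U(Φ₃)(ℂ) = ` ★ `unitaryGroupOfForm (starRingEnd ℂ) Φ₃`** — the carrier of (T3-out-G)'s head `haar_unitaryGroupOfForm_antidiag_three_hsBall_le_quadratic`
(Haar `ν`, `1 ≤ ρ`, `ofReal (C ρ²)` — LH2-p01 (g3)'s GREEN head 99038973b824ea43), which discharges `hgrowth` here token for token. [cite: BeuzartPlessis2020Asterisque, §1.2 (1.2.2), (1.2.4) p. 21; §1.8 p. 39] -/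
theorem measure_setOf_hs_conj_le_linear_unitaryGroupOfForm_antidiag_three
    [MeasurableSpace ↥(unitaryGroupOfForm (starRingEnd ℂ) (Matrix.of fun i j : Fin 3 => if i.val + j.val + 1 = 3 then (1 : ℂ) else 0))]
    (ν : Measure ↥(unitaryGroupOfForm (starRingEnd ℂ) (Matrix.of fun i j : Fin 3 => if i.val + j.val + 1 = 3 then (1 : ℂ) else 0)))
    {u₀ u₁ u₂ : ℂ} (h₀ : ‖u₀‖ = 1) (h₁ : ‖u₁‖ = 1) (h₂ : ‖u₂‖ = 1) (h₀₂ : u₀ ≠ u₂) (h₁₂ : u₁ ≠ u₂)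
    {γ : ↥(unitaryGroupOfForm (starRingEnd ℂ) (Matrix.of fun i j : Fin 3 => if i.val + j.val + 1 = 3 then (1 : ℂ) else 0))}
    (hγ : ((γ : GL (Fin 3) ℂ) : Matrix (Fin 3) (Fin 3) ℂ) = !![(u₀ + u₂) / 2, 0, (u₀ - u₂) / 2; 0, u₁, 0; (u₀ - u₂) / 2, 0, (u₀ + u₂) / 2])
    (hgrowth : ∃ C : ℝ, ∀ ρ : ℝ, 1 ≤ ρ →
      ν {g | ∑ i : Fin 3, ∑ j : Fin 3, ‖((g : GL (Fin 3) ℂ) : Matrix (Fin 3) (Fin 3) ℂ) i j‖ ^ 2 ≤ ρ} ≤ ENNReal.ofReal (C * ρ ^ 2)) :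
    ∃ A : ℝ, 0 ≤ A ∧ ∀ R : ℝ, 1 ≤ R →
      ν {g | ∑ i : Fin 3, ∑ j : Fin 3, ‖(((g * γ * g⁻¹ : ↥(unitaryGroupOfForm (starRingEnd ℂ)
          (Matrix.of fun i j : Fin 3 => if i.val + j.val + 1 = 3 then (1 : ℂ) else 0))) : GL (Fin 3) ℂ) : Matrix (Fin 3) (Fin 3) ℂ) i j‖ ^ 2 ≤ R} ≤
        ENNReal.ofReal (A * R) :=
  measure_setOf_hs_conj_le_linear_of_quadratic_growth (fun _ hg => mem_unitaryGroupOfForm_iff.mp hg) ν h₀ h₁ h₂ h₀₂ h₁₂ hγ hgrowth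

variable (L : Type) [Field L]

/-- The place image of `Φ₃ ∈ M₃(L)` is `Φ₃ ∈ M₃(ℂ)` (entries `0, 1`); private copy of ★ `antidiagOne_three_map_embedding` (`ArchInnerTransferSideCompact`, p848186) to keep the
imports light. [cite: Rogawski1990, §1.9 p. 8] -/
private theorem antidiagOne_three_map_embedding' (w : {w : NumberField.InfinitePlace L // w.IsComplex}) :
    (Matrix.of fun i j : Fin 3 => if i.val + j.val + 1 = 3 then (1 : L) else 0).map w.1.embedding =
      Matrix.of fun i j : Fin 3 => if i.val + j.val + 1 = 3 then (1 : ℂ) else 0 := by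
  ext i j
  simp only [Matrix.map_apply, Matrix.of_apply]
  split_ifs <;> simp

/-- **(E′) on a place factor `U(Φ₃)_w = ` ★ `archLocal L 3 Φ₃ w` of `G_∞ = U(Φ₃)(L⁺ ⊗ ℝ) = U(2,1)^d`** (any measure; the per-place input of (Π′-G)).
[cite: BeuzartPlessis2020Asterisque, §1.2 (1.2.2), (1.2.4) p. 21; §1.8 p. 39] -/
theorem measure_setOf_hs_conj_le_linear_archLocal_antidiag_three (w : {w : NumberField.InfinitePlace L // w.IsComplex})
    [MeasurableSpace ↥(UnitaryGroup.archLocal L 3 (Matrix.of fun i j : Fin 3 => if i.val + j.val + 1 = 3 then (1 : L) else 0) w)]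
    (ν : Measure ↥(UnitaryGroup.archLocal L 3 (Matrix.of fun i j : Fin 3 => if i.val + j.val + 1 = 3 then (1 : L) else 0) w))
    {u₀ u₁ u₂ : ℂ} (h₀ : ‖u₀‖ = 1) (h₁ : ‖u₁‖ = 1) (h₂ : ‖u₂‖ = 1) (h₀₂ : u₀ ≠ u₂) (h₁₂ : u₁ ≠ u₂)
    {γ : ↥(UnitaryGroup.archLocal L 3 (Matrix.of fun i j : Fin 3 => if i.val + j.val + 1 = 3 then (1 : L) else 0) w)}
    (hγ : ((γ : GL (Fin 3) ℂ) : Matrix (Fin 3) (Fin 3) ℂ) = !![(u₀ + u₂) / 2, 0, (u₀ - u₂) / 2; 0, u₁, 0; (u₀ - u₂) / 2, 0, (u₀ + u₂) / 2])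
    (hgrowth : ∃ C : ℝ, ∀ ρ : ℝ, 1 ≤ ρ →
      ν {g | ∑ i : Fin 3, ∑ j : Fin 3, ‖((g : GL (Fin 3) ℂ) : Matrix (Fin 3) (Fin 3) ℂ) i j‖ ^ 2 ≤ ρ} ≤ ENNReal.ofReal (C * ρ ^ 2)) :
    ∃ A : ℝ, 0 ≤ A ∧ ∀ R : ℝ, 1 ≤ R →
      ν {g | ∑ i : Fin 3, ∑ j : Fin 3, ‖(((g * γ * g⁻¹ : ↥(UnitaryGroup.archLocal L 3
          (Matrix.of fun i j : Fin 3 => if i.val + j.val + 1 = 3 then (1 : L) else 0) w)) : GL (Fin 3) ℂ) : Matrix (Fin 3) (Fin 3) ℂ) i j‖ ^ 2 ≤ R} ≤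
        ENNReal.ofReal (A * R) := by
  refine measure_setOf_hs_conj_le_linear_of_quadratic_growth (fun g hg => ?_) ν h₀ h₁ h₂ h₀₂ h₁₂ hγ hgrowth
  have h := (UnitaryGroup.mem_archLocal_iff L 3 _ w g).mp hg
  rw [antidiagOne_three_map_embedding'] at h
  exact h

end Instances

/-! ## §3 Compact centraliser: the bound descends to the Weil quotient measure `dν ∕ dt` (the `hplace` token, exponent `a = 1`) -/

section Quotient

variable {Γ : Subgroup (GL (Fin 3) ℂ)}
  (hΓ : ∀ g : GL (Fin 3) ℂ, g ∈ Γ →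
    ((g : Matrix (Fin 3) (Fin 3) ℂ).map (starRingEnd ℂ))ᵀ * (Matrix.of fun i j : Fin 3 => if i.val + j.val + 1 = 3 then (1 : ℂ) else 0) *
        (g : Matrix (Fin 3) (Fin 3) ℂ) =
      (Matrix.of fun i j : Fin 3 => if i.val + j.val + 1 = 3 then (1 : ℂ) else 0))

include hΓ

/-- **(E′) on the quotient `Γ ⧸ Z(γ)`** for a subgroup `Γ ≤ U(Φ₃)(ℂ)` that is locally compact second countable (e.g. closed), Haar `ν` on `Γ`, Haar `t` on the
COMPACT centraliser `Z(γ)` of the regular elliptic `γ`: the Weil quotient measure (★ `quotientMeasure`) of the orbit HS²-ball `{ḡ ∣ Σ|(gγg⁻¹)_{ij}|² ≤ R}` is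
`≤ A R^1 (1 + log R)^m` for `R ≥ 1`, given the quadratic group growth `hgrowth` — the shape of the `hvol`∕`hplace` hypothesis of ★ p848470 ∕ ★ p848851 ∕ (Π′-G)
at `e = a = 1` (★ p848739 §1 `quotientMeasure_setOf_le_of_compact_of_group_bound`). [cite: BeuzartPlessis2020Asterisque, §1.2 (1.2.2), (1.2.4) p. 21; §1.8 p. 39]
[cite: Folland1995, §2.6 (2.52)] -/
theorem quotientMeasure_setOf_hs_conj_le_of_quadratic_growth
    [LocallyCompactSpace Γ] [SecondCountableTopology Γ] [MeasurableSpace Γ] [BorelSpace Γ]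
    (ν : Measure Γ) [ν.IsHaarMeasure] [ν.IsMulRightInvariant]
    {u₀ u₁ u₂ : ℂ} (h₀ : ‖u₀‖ = 1) (h₁ : ‖u₁‖ = 1) (h₂ : ‖u₂‖ = 1) (h₀₂ : u₀ ≠ u₂) (h₁₂ : u₁ ≠ u₂)
    (γ : Γ) (hγ : ((γ : GL (Fin 3) ℂ) : Matrix (Fin 3) (Fin 3) ℂ) =
      !![(u₀ + u₂) / 2, 0, (u₀ - u₂) / 2; 0, u₁, 0; (u₀ - u₂) / 2, 0, (u₀ + u₂) / 2])
    (hZ : IsClosed (Subgroup.centralizer ({γ} : Set Γ) : Set Γ)) [CompactSpace ↥(Subgroup.centralizer ({γ} : Set Γ))]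
    (t : Measure ↥(Subgroup.centralizer ({γ} : Set Γ))) [t.IsHaarMeasure] [t.IsInvInvariant]
    [MeasurableSpace (Γ ⧸ Subgroup.centralizer ({γ} : Set Γ))] [BorelSpace (Γ ⧸ Subgroup.centralizer ({γ} : Set Γ))]
    (hgrowth : ∃ C : ℝ, ∀ ρ : ℝ, 1 ≤ ρ →
      ν {g : Γ | ∑ i : Fin 3, ∑ j : Fin 3, ‖((g : GL (Fin 3) ℂ) : Matrix (Fin 3) (Fin 3) ℂ) i j‖ ^ 2 ≤ ρ} ≤ ENNReal.ofReal (C * ρ ^ 2)) :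
    ∃ (A : ℝ) (m : ℕ), ∀ R : ℝ, 1 ≤ R →
      quotientMeasure (Subgroup.centralizer ({γ} : Set Γ)) t hZ ν
          {x | descConj γ (Subgroup.centralizer ({γ} : Set Γ)) (fun _ h => Subgroup.mem_centralizer_singleton_iff.1 h)
              (fun g : Γ => ∑ i : Fin 3, ∑ j : Fin 3, ‖((g : GL (Fin 3) ℂ) : Matrix (Fin 3) (Fin 3) ℂ) i j‖ ^ 2) x ≤ R} ≤
        ENNReal.ofReal (A * R ^ (1 : ℝ) * (1 + Real.log R) ^ m) := by
  -- measurability of the orbit radius on the quotient (continuity)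
  have hA : Continuous fun g : Γ => ((g : GL (Fin 3) ℂ) : Matrix (Fin 3) (Fin 3) ℂ) := Units.continuous_val.comp continuous_subtype_val
  have hcont : Continuous fun g : Γ => ∑ i : Fin 3, ∑ j : Fin 3, ‖((g : GL (Fin 3) ℂ) : Matrix (Fin 3) (Fin 3) ℂ) i j‖ ^ 2 := by
    refine continuous_finsetSum _ fun i _ => continuous_finsetSum _ fun j _ => ?_
    exact (continuous_norm.comp (hA.matrix_elem i j)).pow 2
  have hP : Measurable (descConj γ (Subgroup.centralizer ({γ} : Set Γ)) (fun _ h => Subgroup.mem_centralizer_singleton_iff.1 h)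
      (fun g : Γ => ∑ i : Fin 3, ∑ j : Fin 3, ‖((g : GL (Fin 3) ℂ) : Matrix (Fin 3) (Fin 3) ℂ) i j‖ ^ 2)) :=
    (continuous_descConj _ _ _ hcont).measurable
  refine quotientMeasure_setOf_le_of_compact_of_group_bound _ hZ t ν hP ?_
  -- the group-level bound: `P (mk g) = Σ|(g γ g⁻¹)_{ij}|²`
  obtain ⟨A, m, hA⟩ := measure_setOf_hs_conj_le_rpow_one_of_quadratic_growth hΓ ν h₀ h₁ h₂ h₀₂ h₁₂ hγ hgrowth
  refine ⟨A, m, fun R hR => ?_⟩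
  have hset : {g : Γ | descConj γ (Subgroup.centralizer ({γ} : Set Γ)) (fun _ h => Subgroup.mem_centralizer_singleton_iff.1 h)
        (fun g : Γ => ∑ i : Fin 3, ∑ j : Fin 3, ‖((g : GL (Fin 3) ℂ) : Matrix (Fin 3) (Fin 3) ℂ) i j‖ ^ 2) (QuotientGroup.mk g) ≤ R} =
      {g : Γ | ∑ i : Fin 3, ∑ j : Fin 3, ‖(((g * γ * g⁻¹ : Γ) : GL (Fin 3) ℂ) : Matrix (Fin 3) (Fin 3) ℂ) i j‖ ^ 2 ≤ R} := by
    ext g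
    simp only [Set.mem_setOf_eq, descConj_mk]
  rw [hset]
  exact hA R hR


/-- **The same, LOG-FREE, in the `hplace` shape `C · R^a` (`a = 1`)** of the product assembly (Π′-G): for the compact centraliser `Z(γ)` the Weil quotient measure is
`t(Z)⁻¹ · π_* ν` (★ `quotientMeasure_eq_inv_smul_map_mk`), so the linear group bound descends with constant `t(Z)⁻¹ · A`. [cite: Folland1995, §2.6 (2.52)]
[cite: BeuzartPlessis2020Asterisque, §1.2 (1.2.2), (1.2.4) p. 21; §1.8 p. 39] -/
theorem quotientMeasure_setOf_hs_conj_le_linear_of_quadratic_growth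
    [LocallyCompactSpace Γ] [SecondCountableTopology Γ] [MeasurableSpace Γ] [BorelSpace Γ]
    (ν : Measure Γ) [ν.IsHaarMeasure] [ν.IsMulRightInvariant]
    {u₀ u₁ u₂ : ℂ} (h₀ : ‖u₀‖ = 1) (h₁ : ‖u₁‖ = 1) (h₂ : ‖u₂‖ = 1) (h₀₂ : u₀ ≠ u₂) (h₁₂ : u₁ ≠ u₂)
    (γ : Γ) (hγ : ((γ : GL (Fin 3) ℂ) : Matrix (Fin 3) (Fin 3) ℂ) =
      !![(u₀ + u₂) / 2, 0, (u₀ - u₂) / 2; 0, u₁, 0; (u₀ - u₂) / 2, 0, (u₀ + u₂) / 2])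
    (hZ : IsClosed (Subgroup.centralizer ({γ} : Set Γ) : Set Γ)) [CompactSpace ↥(Subgroup.centralizer ({γ} : Set Γ))]
    (t : Measure ↥(Subgroup.centralizer ({γ} : Set Γ))) [t.IsHaarMeasure] [t.IsInvInvariant]
    [MeasurableSpace (Γ ⧸ Subgroup.centralizer ({γ} : Set Γ))] [BorelSpace (Γ ⧸ Subgroup.centralizer ({γ} : Set Γ))]
    (hgrowth : ∃ C : ℝ, ∀ ρ : ℝ, 1 ≤ ρ →
      ν {g : Γ | ∑ i : Fin 3, ∑ j : Fin 3, ‖((g : GL (Fin 3) ℂ) : Matrix (Fin 3) (Fin 3) ℂ) i j‖ ^ 2 ≤ ρ} ≤ ENNReal.ofReal (C * ρ ^ 2)) :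
    ∃ C : ℝ, ∀ R : ℝ, 1 ≤ R →
      quotientMeasure (Subgroup.centralizer ({γ} : Set Γ)) t hZ ν
          {x | descConj γ (Subgroup.centralizer ({γ} : Set Γ)) (fun _ h => Subgroup.mem_centralizer_singleton_iff.1 h)
              (fun g : Γ => ∑ i : Fin 3, ∑ j : Fin 3, ‖((g : GL (Fin 3) ℂ) : Matrix (Fin 3) (Fin 3) ℂ) i j‖ ^ 2) x ≤ R} ≤
        ENNReal.ofReal (C * R ^ (1 : ℝ)) := by
  haveI : IsClosed (Subgroup.centralizer ({γ} : Set Γ) : Set Γ) := hZ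
  obtain ⟨A, hA0, hA⟩ := measure_setOf_hs_conj_le_linear_of_quadratic_growth hΓ ν h₀ h₁ h₂ h₀₂ h₁₂ hγ hgrowth
  have ht0 : t Set.univ ≠ 0 := (isOpen_univ.measure_pos t Set.univ_nonempty).ne'
  have httop : t Set.univ ≠ ⊤ := (isCompact_univ.measure_lt_top (μ := t)).ne
  set c : ℝ := (t Set.univ).toReal⁻¹ with hc
  have hcpos : 0 < c := inv_pos.mpr (ENNReal.toReal_pos ht0 httop)
  have hcinv : (t Set.univ)⁻¹ = ENNReal.ofReal c := by
    rw [hc, ENNReal.ofReal_inv_of_pos (ENNReal.toReal_pos ht0 httop), ENNReal.ofReal_toReal httop]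
  -- measurability of the orbit radius on the quotient
  have hAcont : Continuous fun g : Γ => ((g : GL (Fin 3) ℂ) : Matrix (Fin 3) (Fin 3) ℂ) := Units.continuous_val.comp continuous_subtype_val
  have hcont : Continuous fun g : Γ => ∑ i : Fin 3, ∑ j : Fin 3, ‖((g : GL (Fin 3) ℂ) : Matrix (Fin 3) (Fin 3) ℂ) i j‖ ^ 2 := by
    refine continuous_finsetSum _ fun i _ => continuous_finsetSum _ fun j _ => ?_
    exact (continuous_norm.comp (hAcont.matrix_elem i j)).pow 2
  have hP : Measurable (descConj γ (Subgroup.centralizer ({γ} : Set Γ)) (fun _ h => Subgroup.mem_centralizer_singleton_iff.1 h)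
      (fun g : Γ => ∑ i : Fin 3, ∑ j : Fin 3, ‖((g : GL (Fin 3) ℂ) : Matrix (Fin 3) (Fin 3) ℂ) i j‖ ^ 2)) :=
    (continuous_descConj _ _ _ hcont).measurable
  refine ⟨c * A, fun R hR => ?_⟩
  have hS : MeasurableSet {x : Γ ⧸ Subgroup.centralizer ({γ} : Set Γ) |
      descConj γ (Subgroup.centralizer ({γ} : Set Γ)) (fun _ h => Subgroup.mem_centralizer_singleton_iff.1 h)
        (fun g : Γ => ∑ i : Fin 3, ∑ j : Fin 3, ‖((g : GL (Fin 3) ℂ) : Matrix (Fin 3) (Fin 3) ℂ) i j‖ ^ 2) x ≤ R} :=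
    measurableSet_le hP measurable_const
  rw [quotientMeasure_eq_inv_smul_map_mk (Subgroup.centralizer ({γ} : Set Γ)) t ν, Measure.smul_apply,
    Measure.map_apply QuotientGroup.continuous_mk.measurable hS, smul_eq_mul, hcinv, Real.rpow_one]
  have hpre : (QuotientGroup.mk : Γ → Γ ⧸ Subgroup.centralizer ({γ} : Set Γ)) ⁻¹'
        {x | descConj γ (Subgroup.centralizer ({γ} : Set Γ)) (fun _ h => Subgroup.mem_centralizer_singleton_iff.1 h)
          (fun g : Γ => ∑ i : Fin 3, ∑ j : Fin 3, ‖((g : GL (Fin 3) ℂ) : Matrix (Fin 3) (Fin 3) ℂ) i j‖ ^ 2) x ≤ R} =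
      {g : Γ | ∑ i : Fin 3, ∑ j : Fin 3, ‖(((g * γ * g⁻¹ : Γ) : GL (Fin 3) ℂ) : Matrix (Fin 3) (Fin 3) ℂ) i j‖ ^ 2 ≤ R} := by
    ext g
    simp only [Set.mem_preimage, Set.mem_setOf_eq, descConj_mk]
  rw [hpre]
  calc ENNReal.ofReal c * ν {g : Γ | ∑ i : Fin 3, ∑ j : Fin 3, ‖(((g * γ * g⁻¹ : Γ) : GL (Fin 3) ℂ) : Matrix (Fin 3) (Fin 3) ℂ) i j‖ ^ 2 ≤ R}
      ≤ ENNReal.ofReal c * ENNReal.ofReal (A * R) := mul_le_mul' le_rfl (hA R hR)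
    _ = ENNReal.ofReal (c * A * R) := by rw [← ENNReal.ofReal_mul hcpos.le, mul_assoc]

end Quotient

end Literature.NumberTheory.Rogawski1990

end
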